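import Literature.Analysis.FluidPDE.NSBootstrapBase
import Literature.Analysis.FluidPDE.NSBootstrapStep
import HarnessLib

/-!
# The Serrin bootstrap: all levels

Analysis/FluidPDE proofs file (theorems only). The induction on the number of space derivatives
(Seregin–Šverák 2009, §2 p. 8: "for any natural `k` … Proof of this statements can be done by
induction"; Lemarié-Rieusset 2016, Thm. 13.1) assembled from `NSBootstrap.level_zero` and
`NSBootstrap.level_step`: for every `n` and every cylinder `C(L', ρ')` strictly inside
`C(r₀², r₀)`, `r₀ < R`, a constant `K` fixed before the solution such that every bounded
distributional solution on `Q(0, R)` with `∫∫ |p|^{3/2} ≤ P` carries level-`n` data bounded by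
`K` on `C(L', ρ')` together with the base identities (`all_levels`).

## References

* G. Seregin, V. Šverák, Comm. PDE 34 (2009) = arXiv:0804.1803, §2 p. 8. [`SereginSverak2009`]
* P. G. Lemarié-Rieusset, *The Navier–Stokes Problem in the 21st Century* (2016), Thm. 13.1.
  [`LemarieRieusset2016`]
-/

noncomputable section

open MeasureTheory Set Function Filter Topology TopologicalSpace Metric
open scoped NNReal ENNReal RealInnerProductSpace Laplacian

namespace Literature.Analysis.FluidPDE

namespace NSBootstrap

open RepDeriv

/-- **All levels of the bootstrap, with the bounds fixed before the solution.** For `n : ℕ`,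
`0 < r₀ < R` and a cylinder `C(L', ρ')` with `0 < L' < r₀²`, `0 < ρ' < r₀`, there is `K` such
that every bounded distributional Navier–Stokes solution `(u, p)` on `Q(0, R)` with `|u| ≤ M`
a.e. and `∫∫ |p|^{3/2} ≤ P` has a weak spatial gradient `G` on `C(r₀², r₀)` and level-`n` data
bounded by `K` on `C(L', ρ')`, where the base identities hold.
[cite: SereginSverak2009, §2 p. 8] -/
theorem all_levels (n : ℕ) {R r₀ : ℝ} (hr₀ : 0 < r₀) (hr₀R : r₀ < R) (M : ℝ) (P : ℝ≥0) :
    ∀ {L' ρ' : ℝ}, 0 < L' → L' < r₀ ^ 2 → 0 < ρ' → ρ' < r₀ →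
    ∃ K : ℝ≥0, ∀ (u : ℝ → EuclideanSpace ℝ (Fin 3) → EuclideanSpace ℝ (Fin 3))
      (p : ℝ → EuclideanSpace ℝ (Fin 3) → ℝ),
      IsDistributionalNSSolutionOn (parabolicCylinderOpens R (0 : ℝ × EuclideanSpace ℝ (Fin 3))) 1 0 u p →
      (∀ᵐ w ∂(volume.restrict (parabolicCylinder R (0 : ℝ × EuclideanSpace ℝ (Fin 3)))), ‖u w.1 w.2‖ ≤ M) →
      (∫⁻ w in parabolicCylinder R (0 : ℝ × EuclideanSpace ℝ (Fin 3)), ‖p w.1 w.2‖ₑ ^ (3 / 2 : ℝ) ≤ P) →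
      ∃ (G : ℝ → EuclideanSpace ℝ (Fin 3) → EuclideanSpace ℝ (Fin 3) →L[ℝ] EuclideanSpace ℝ (Fin 3))
        (U : List (Fin 3) → Fin 3 → ℝ × EuclideanSpace ℝ (Fin 3) → ℝ)
        (A : List (Fin 3) → Fin 3 → Fin 3 → ℝ × EuclideanSpace ℝ (Fin 3) → ℝ),
        HasWeakSpatialGradientOn (cylOpens (r₀ ^ 2) r₀) u G ∧ BaseHeat u G L' ρ' ∧ BasePoisson u G L' ρ' ∧
        LevelData u G L' ρ' n K U A := by
  induction n with
  | zero =>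
    intro L' ρ' hL' hL'r hρ' hρ'r
    obtain ⟨K₀, hK₀⟩ := level_zero hr₀ hr₀R M P
    refine ⟨K₀, fun u p hsol hbd hP => ?_⟩
    obtain ⟨G, hG, hheat, hpoi, U, A, hdata⟩ := hK₀ u p hsol hbd hP
    exact ⟨G, U, A, hG, hheat.mono hL'r.le hρ'r.le, hpoi.mono hL'r.le hρ'r.le,
      hdata.mono hL'r.le hρ'r.le le_rfl le_rfl⟩
  | succ n ih =>
    intro L' ρ' hL' hL'r hρ' hρ'r
    -- an intermediate cylinder
    set L'' : ℝ := (L' + r₀ ^ 2) / 2 with hL''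
    set ρ'' : ℝ := (ρ' + r₀) / 2 with hρ''
    have h1 : L' < L'' := by rw [hL'']; linarith
    have h2 : L'' < r₀ ^ 2 := by rw [hL'']; linarith
    have h3 : ρ' < ρ'' := by rw [hρ'']; linarith
    have h4 : ρ'' < r₀ := by rw [hρ'']; linarith
    obtain ⟨Kn, hKn⟩ := ih (hL'.trans h1) h2 (hρ'.trans h3) h4
    obtain ⟨Φ, hΦ⟩ := level_step n hL' h1 hρ' h3
    refine ⟨Φ Kn, fun u p hsol hbd hP => ?_⟩
    obtain ⟨G, U, A, hG, hheat, hpoi, hdata⟩ := hKn u p hsol hbd hP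
    obtain ⟨U', A', -, hdata'⟩ := hΦ Kn u G U A hheat hpoi hdata
    exact ⟨G, U', A', hG, hheat.mono h1.le h3.le, hpoi.mono h1.le h3.le, hdata'⟩

end NSBootstrap

end Literature.Analysis.FluidPDE

end
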